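import Summits.NavierStokesRegularity.NavierStokesRegularity.Theorems.UnthreadedDoorCellFluxDefs
import Literature.Analysis.Calculus.RealAnalyticSignSetFiniteness
import Literature.ModelTheory.ExponentialFields.RealAnExp
import HarnessLib

/-!
# Route `UnthreadedDoor`, crux `PoloidalLiouville` (stmt-NavierStokesRegularity-1222), WALL W1 — crux idea «indicatrix-bound» (ns-idea-14):
# Λ-geo `AnalyticCellFiniteness` — analytic slices are CELL-FINITE (M-Lean bridge from F1, Bierstone–Milman Cor. 2.7 (2))

Support file (theorems only; `--supports stmt-NavierStokesRegularity-1222 --as helper`).  The registered stub Λ-geo of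
`Cruxes/PoloidalLiouville/IndicatrixSketch.lean` (v1.7.3) is the implication
`stub_analyticCellFiniteness : BierstoneMilman1988_signSet_components_finite → AnalyticCellFiniteness`: for `f` real-analytic off the centre `x₀`
and `r > 0`, the sphere `S_r(x₀)` carries finitely many CELLS (connected components of `S_r ∖ Γ`, `Γ` = sheet trace = the non-isolated part of
the sphere-critical set `sphCrit f x₀ r`) and finitely many ISOLATED sphere-critical points.  Proof (the custodian's recipe, v1.5):
* the sphere-critical set is the SIGN SET `{h = 0, g = 0}` and its complement in the sphere is `{h = 0, g ≠ 0}` for the two functions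
  `h = ‖· − x₀‖² − r²`, `g = ‖∇f × (· − x₀)‖²`, analytic on `U = {x₀}ᶜ` (`AnalyticOnNhd.fderiv`, the Riesz map as a real continuous linear map,
  the bilinear maps `crossCLM` / `innerSL`), with `{h = 0} = S_r` compact — so F1 gives finitely many connected components of both;
* an ISOLATED point of a set is its own connected component (`connectedComponentIn_eq_singleton_of_not_accPt`), so `isoCrit` injects into the
  components of `sphCrit` — finite;
* `S_r ∖ Γ = (S_r ∖ sphCrit) ∪ isoCrit`, and the cell map `cellOf` is constant on every connected component of `S_r ∖ sphCrit`
  (`connectedComponentIn_mono` + `connectedComponentIn_eq`), so `cellSet` is covered by one cell per component of `S_r ∖ sphCrit` plus one per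
  isolated critical point — finite.
Main: `analyticCellFiniteness_of : <F1 body verbatim> → <Λ-geo body verbatim>` and, by name over the tree's derivation of F1 from the one standing
fact «`ℝ_an,exp` is o-minimal» (p710694), `analyticCellFiniteness_of_realAnExp`.  Nothing here is about Navier–Stokes; ⟨1222⟩, W1 and NS
regularity stay OPEN.  ARM A `pub/ns-exp-scalarLiouville` g8.
-/

noncomputable section

-- the summit and its single sub-problem share the name (CONVENTIONS §1)
set_option linter.dupNamespace false

open Set Function Filter Topology
open scoped RealInnerProductSpace

namespace Summit.NavierStokesRegularity.NavierStokesRegularity.Theorems.PoloidalLiouville.Indicatrix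

open Summit.NavierStokesRegularity.NavierStokesRegularity.Theorems.PoloidalLiouville.NetFlux (E3)
open Summit.NavierStokesRegularity.NavierStokesRegularity.Theorems.PoloidalLiouville.CellFlux
  (sphCrit sheetTrace isoCrit cellOf cellSet)
open Literature.Analysis Literature.Analysis.FluidPDE

/-! ### Topology: isolated points and components -/

/-- **An isolated point of a set is its own connected component** (T₁ separation + preconnectedness). [folklore] -/
theorem connectedComponentIn_eq_singleton_of_not_accPt {X : Type*} [TopologicalSpace X] [T1Space X] {S : Set X} {x : X}
    (hx : x ∈ S) (hacc : ¬ AccPt x (𝓟 S)) : connectedComponentIn S x = {x} := by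
  rw [accPt_iff_nhds] at hacc
  push Not at hacc
  obtain ⟨U, hU, hUS⟩ := hacc
  obtain ⟨V, hVU, hVo, hxV⟩ := mem_nhds_iff.1 hU
  refine subset_antisymm ?_ (singleton_subset_iff.2 (mem_connectedComponentIn hx))
  intro y hy
  by_contra hyx
  have hpre : IsPreconnected (connectedComponentIn S x) := isPreconnected_connectedComponentIn
  have hsub : connectedComponentIn S x ⊆ V ∪ {x}ᶜ := fun z _ => by
    by_cases hz : z = x
    · exact Or.inl (hz ▸ hxV)
    · exact Or.inr hz
  obtain ⟨z, hzC, hzV, hzx⟩ := hpre V {x}ᶜ hVo isOpen_compl_singleton hsub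
    ⟨x, mem_connectedComponentIn hx, hxV⟩ ⟨y, hy, hyx⟩
  exact hzx (hUS z ⟨hVU hzV, connectedComponentIn_subset _ _ hzC⟩)

/-- The isolated points of a set whose family of connected components is finite form a finite set. [folklore] -/
theorem finite_isolated_of_finite_components {X : Type*} [TopologicalSpace X] [T1Space X] {S : Set X}
    (hfin : (connectedComponentIn S '' S).Finite) : {x | x ∈ S ∧ ¬ AccPt x (𝓟 S)}.Finite := by
  have hsub : {x | x ∈ S ∧ ¬ AccPt x (𝓟 S)} ⊆ S := fun x hx => hx.1
  refine Finite.of_finite_image ((hfin.subset (image_mono hsub))) ?_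
  intro x hx y hy hxy
  have h1 := connectedComponentIn_eq_singleton_of_not_accPt hx.1 hx.2
  have h2 := connectedComponentIn_eq_singleton_of_not_accPt hy.1 hy.2
  have h3 : ({x} : Set X) = {y} := by rw [← h1, ← h2]; exact hxy
  exact singleton_eq_singleton_iff.1 h3

/-- Components of `A ∪ I` inside a larger set: the component map of `B ⊇ A` is constant on each connected component of `A`, so the components
of `B` through points of `A` are at most as many as the components of `A`. [folklore] -/
theorem finite_image_connectedComponentIn_of_subset {X : Type*} [TopologicalSpace X] {A B : Set X} (hAB : A ⊆ B)
    (hfin : (connectedComponentIn A '' A).Finite) : (connectedComponentIn B '' A).Finite := by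
  set G : Set X → Set X := fun D => ⋃ y ∈ D, connectedComponentIn B y with hG
  refine (hfin.image G).subset ?_
  rintro C ⟨x, hxA, rfl⟩
  refine ⟨connectedComponentIn A x, ⟨x, hxA, rfl⟩, ?_⟩
  have heq : ∀ y ∈ connectedComponentIn A x, connectedComponentIn B y = connectedComponentIn B x := fun y hy =>
    (connectedComponentIn_eq (connectedComponentIn_mono x hAB hy)).symm
  refine subset_antisymm (iUnion₂_subset fun y hy => (heq y hy).le) ?_
  exact subset_iUnion₂_of_subset x (mem_connectedComponentIn hxA) Subset.rfl

/-- Counting version of `finite_isolated_of_finite_components`: the isolated points are at most as many as the components. [folklore] -/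
theorem ncard_isolated_le_ncard_components {X : Type*} [TopologicalSpace X] [T1Space X] {S : Set X}
    (hfin : (connectedComponentIn S '' S).Finite) :
    {x | x ∈ S ∧ ¬ AccPt x (𝓟 S)}.ncard ≤ (connectedComponentIn S '' S).ncard := by
  refine ncard_le_ncard_of_injOn (connectedComponentIn S) (fun x hx => ⟨x, hx.1, rfl⟩) ?_ hfin
  intro x hx y hy hxy
  have h1 := connectedComponentIn_eq_singleton_of_not_accPt hx.1 hx.2
  have h2 := connectedComponentIn_eq_singleton_of_not_accPt hy.1 hy.2
  have h3 : ({x} : Set X) = {y} := by rw [← h1, ← h2]; exact hxy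
  exact singleton_eq_singleton_iff.1 h3

/-- Counting version of `finite_image_connectedComponentIn_of_subset`. [folklore] -/
theorem ncard_image_connectedComponentIn_of_subset_le {X : Type*} [TopologicalSpace X] {A B : Set X} (hAB : A ⊆ B)
    (hfin : (connectedComponentIn A '' A).Finite) :
    (connectedComponentIn B '' A).ncard ≤ (connectedComponentIn A '' A).ncard := by
  set G : Set X → Set X := fun D => ⋃ y ∈ D, connectedComponentIn B y with hG
  have hsub : connectedComponentIn B '' A ⊆ G '' (connectedComponentIn A '' A) := by
    rintro C ⟨x, hxA, rfl⟩
    refine ⟨connectedComponentIn A x, ⟨x, hxA, rfl⟩, ?_⟩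
    have heq : ∀ y ∈ connectedComponentIn A x, connectedComponentIn B y = connectedComponentIn B x := fun y hy =>
      (connectedComponentIn_eq (connectedComponentIn_mono x hAB hy)).symm
    refine subset_antisymm (iUnion₂_subset fun y hy => (heq y hy).le) ?_
    exact subset_iUnion₂_of_subset x (mem_connectedComponentIn hxA) Subset.rfl
  exact (ncard_le_ncard hsub (hfin.image G)).trans (ncard_image_le hfin)

/-! ### The sign-set description of the sphere-critical set -/

/-- The sphere-critical set is the sign set `{h = 0, g = 0}` on `U = {x₀}ᶜ` with `h = ‖· − x₀‖² − r²`, `g = ‖∇f × (· − x₀)‖²` (`r > 0`). [folklore] -/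
theorem sphCrit_eq_signSet' (f : E3 → ℝ) (x₀ : E3) {r : ℝ} (hr : 0 < r) :
    sphCrit f x₀ r =
      {x : E3 | x ∈ ({x₀}ᶜ : Set E3) ∧ ‖x - x₀‖ ^ 2 - r ^ 2 = 0 ∧ ‖cross (gradient f x) (x - x₀)‖ ^ 2 = 0} := by
  ext x
  simp only [sphCrit, Set.mem_setOf_eq, mem_sphere_iff_norm, Set.mem_compl_iff, Set.mem_singleton_iff]
  constructor
  · rintro ⟨h1, h2⟩
    refine ⟨?_, ?_, ?_⟩
    · intro hx
      rw [hx, sub_self, norm_zero] at h1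
      linarith
    · rw [h1, sub_self]
    · rw [h2, norm_zero]
      norm_num
  · rintro ⟨-, h1, h2⟩
    refine ⟨?_, ?_⟩
    · have h3 : (‖x - x₀‖ - r) * (‖x - x₀‖ + r) = 0 := by
        have h3' : (‖x - x₀‖ - r) * (‖x - x₀‖ + r) = ‖x - x₀‖ ^ 2 - r ^ 2 := by ring
        rw [h3', h1]
      rcases mul_eq_zero.mp h3 with h4 | h4
      · linarith
      · have hn : 0 ≤ ‖x - x₀‖ := norm_nonneg _
        linarith
    · have h5 : ‖cross (gradient f x) (x - x₀)‖ = 0 := (pow_eq_zero_iff two_ne_zero).mp h2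
      exact norm_eq_zero.mp h5

/-- The complement of the sphere-critical set in the sphere is the sign set `{h = 0, g ≠ 0}`. [folklore] -/
theorem sphere_diff_sphCrit_eq_signSet (f : E3 → ℝ) (x₀ : E3) {r : ℝ} (hr : 0 < r) :
    Metric.sphere x₀ r \ sphCrit f x₀ r =
      {x : E3 | x ∈ ({x₀}ᶜ : Set E3) ∧ ‖x - x₀‖ ^ 2 - r ^ 2 = 0 ∧ ‖cross (gradient f x) (x - x₀)‖ ^ 2 ≠ 0} := by
  ext x
  simp only [Set.mem_sdiff, sphCrit, Set.mem_setOf_eq, mem_sphere_iff_norm, Set.mem_compl_iff, Set.mem_singleton_iff]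
  constructor
  · rintro ⟨h1, h2⟩
    have hx : x ≠ x₀ := fun hx => by
      rw [hx, sub_self, norm_zero] at h1
      linarith
    refine ⟨hx, by rw [h1, sub_self], fun hg => h2 ⟨h1, ?_⟩⟩
    exact norm_eq_zero.mp ((pow_eq_zero_iff two_ne_zero).mp hg)
  · rintro ⟨-, hh, hg⟩
    have h1 : ‖x - x₀‖ = r := by
      have h3 : (‖x - x₀‖ - r) * (‖x - x₀‖ + r) = 0 := by
        have h3' : (‖x - x₀‖ - r) * (‖x - x₀‖ + r) = ‖x - x₀‖ ^ 2 - r ^ 2 := by ring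
        rw [h3', hh]
      rcases mul_eq_zero.mp h3 with h4 | h4
      · linarith
      · have hn : 0 ≤ ‖x - x₀‖ := norm_nonneg _
        linarith
    refine ⟨h1, fun hc => hg ?_⟩
    rw [hc.2, norm_zero]
    norm_num

/-- `{x ∈ {x₀}ᶜ | ‖x − x₀‖² − r² = 0} = S_r(x₀)` for `r > 0`; in particular it is compact. [folklore] -/
theorem zeroSet_h_eq_sphere (x₀ : E3) {r : ℝ} (hr : 0 < r) :
    {x : E3 | x ∈ ({x₀}ᶜ : Set E3) ∧ ‖x - x₀‖ ^ 2 - r ^ 2 = 0} = Metric.sphere x₀ r := by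
  ext x
  simp only [mem_setOf_eq, mem_sphere_iff_norm, mem_compl_iff, mem_singleton_iff]
  constructor
  · rintro ⟨-, hh⟩
    have h1 : (‖x - x₀‖ - r) * (‖x - x₀‖ + r) = 0 := by
      have : (‖x - x₀‖ - r) * (‖x - x₀‖ + r) = ‖x - x₀‖ ^ 2 - r ^ 2 := by ring
      rw [this, hh]
    rcases mul_eq_zero.1 h1 with h | h
    · linarith
    · linarith [norm_nonneg (x - x₀)]
  · intro h1
    refine ⟨fun hx => ?_, by rw [h1, sub_self]⟩
    rw [hx, sub_self, norm_zero] at h1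
    exact hr.ne' h1.symm

/-! ### Analyticity of `h` and `g` -/

/-- The gradient of a function analytic on a set is analytic there (the Riesz identification `(E3)' → E3` is a real continuous linear
map). [folklore] -/
theorem analyticOnNhd_gradient {f : E3 → ℝ} {U : Set E3} (hf : AnalyticOnNhd ℝ f U) :
    AnalyticOnNhd ℝ (gradient f) U := by
  obtain ⟨Φ, hΦ⟩ : ∃ Φ : (E3 →L[ℝ] ℝ) →L[ℝ] E3, ∀ L, Φ L = (InnerProductSpace.toDual ℝ E3).symm L :=
    ⟨{ toFun := fun L => (InnerProductSpace.toDual ℝ E3).symm L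
       map_add' := fun L L' => by simp
       map_smul' := fun c L => by simp
       cont := (InnerProductSpace.toDual ℝ E3).symm.continuous }, fun _ => rfl⟩
  have h : gradient f = Φ ∘ fderiv ℝ f := by
    funext x; rw [comp_apply, hΦ]; rfl
  rw [h]
  exact (Φ.analyticOnNhd univ).comp hf.fderiv (fun _ _ => mem_univ _)

/-- `h = ‖· − x₀‖² − r²` is analytic. [folklore] -/
theorem analyticOnNhd_h (x₀ : E3) (r : ℝ) (U : Set E3) :
    AnalyticOnNhd ℝ (fun x : E3 => ‖x - x₀‖ ^ 2 - r ^ 2) U := by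
  have h1 : AnalyticOnNhd ℝ (fun x : E3 => x - x₀) U := analyticOnNhd_id.sub analyticOnNhd_const
  have h2 : AnalyticOnNhd ℝ (fun x : E3 => ⟪x - x₀, x - x₀⟫) U :=
    ((innerSL ℝ (E := E3)).analyticOnNhd_bilinear univ).comp₂ h1 h1 (fun _ _ => mem_univ _)
  have h3 : (fun x : E3 => ‖x - x₀‖ ^ 2 - r ^ 2) = fun x => ⟪x - x₀, x - x₀⟫ - r ^ 2 := by
    funext x; rw [real_inner_self_eq_norm_sq]
  rw [h3]
  exact h2.sub analyticOnNhd_const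

/-- `g = ‖∇f × (· − x₀)‖²` is analytic where `f` is. [folklore] -/
theorem analyticOnNhd_g {f : E3 → ℝ} {U : Set E3} (hf : AnalyticOnNhd ℝ f U) (x₀ : E3) :
    AnalyticOnNhd ℝ (fun x : E3 => ‖cross (gradient f x) (x - x₀)‖ ^ 2) U := by
  have h1 : AnalyticOnNhd ℝ (fun x : E3 => x - x₀) U := analyticOnNhd_id.sub analyticOnNhd_const
  have h2 : AnalyticOnNhd ℝ (fun x : E3 => cross (gradient f x) (x - x₀)) U := by
    have := (crossCLM.analyticOnNhd_bilinear univ).comp₂ (analyticOnNhd_gradient hf) h1 (fun _ _ => mem_univ _)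
    simpa only [crossCLM_apply] using this
  have h3 : AnalyticOnNhd ℝ (fun x : E3 => ⟪cross (gradient f x) (x - x₀), cross (gradient f x) (x - x₀)⟫) U :=
    ((innerSL ℝ (E := E3)).analyticOnNhd_bilinear univ).comp₂ h2 h2 (fun _ _ => mem_univ _)
  have h4 : (fun x : E3 => ‖cross (gradient f x) (x - x₀)‖ ^ 2) =
      fun x => ⟪cross (gradient f x) (x - x₀), cross (gradient f x) (x - x₀)⟫ := by
    funext x; rw [real_inner_self_eq_norm_sq]
  rw [h4]; exact h3

/-! ### Λ-geo -/

/-- `S_r ∖ Γ = (S_r ∖ sphCrit) ∪ isoCrit`. [folklore] -/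
theorem sphere_diff_sheetTrace_eq (f : E3 → ℝ) (x₀ : E3) (r : ℝ) :
    Metric.sphere x₀ r \ sheetTrace f x₀ r = (Metric.sphere x₀ r \ sphCrit f x₀ r) ∪ isoCrit f x₀ r := by
  ext x
  constructor
  · rintro ⟨hs, h⟩
    by_cases hc : x ∈ sphCrit f x₀ r
    · exact Or.inr ⟨hc, h⟩
    · exact Or.inl ⟨hs, hc⟩
  · rintro (⟨hs, hc⟩ | ⟨hc, h⟩)
    · exact ⟨hs, fun h' => hc h'.1⟩
    · exact ⟨hc.1, h⟩

/-- **Counting step (i)** (re-used fibrewise by Λ-geo′(a)/(b), Λ-geo‴): if the sphere-critical set has finitely many connected components, the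
ISOLATED sphere-critical points are finitely many — at most the number of components. [folklore] -/
theorem isoCrit_finite_of_components_finite (f : E3 → ℝ) (x₀ : E3) (r : ℝ)
    (h0 : (connectedComponentIn (sphCrit f x₀ r) '' sphCrit f x₀ r).Finite) :
    (isoCrit f x₀ r).Finite ∧ (isoCrit f x₀ r).ncard ≤ (connectedComponentIn (sphCrit f x₀ r) '' sphCrit f x₀ r).ncard := by
  have hiso : isoCrit f x₀ r = {x | x ∈ sphCrit f x₀ r ∧ ¬ AccPt x (𝓟 (sphCrit f x₀ r))} := by
    ext x
    constructor
    · intro hx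
      have hx1 : x ∈ sphCrit f x₀ r := hx.1
      have hx2 : x ∉ sheetTrace f x₀ r := hx.2
      exact ⟨hx1, fun hacc => hx2 ⟨hx1, hacc⟩⟩
    · rintro ⟨hx1, hx2⟩
      exact ⟨hx1, fun h => hx2 h.2⟩
  rw [hiso]
  exact ⟨finite_isolated_of_finite_components h0, ncard_isolated_le_ncard_components h0⟩

/-- **Counting step (ii)** (re-used fibrewise by Λ-geo′(a)/(b), Λ-geo‴): if both the sphere-critical set and its complement in the sphere have
finitely many connected components, the CELLS are finitely many — at most (components of the complement) + (components of the critical set);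
no regularity of `f` is used (`S_r ∖ Γ = (S_r ∖ sphCrit) ∪ isoCrit`, the cell map is constant on components of `S_r ∖ sphCrit`). [folklore] -/
theorem cellSet_finite_of_components_finite (f : E3 → ℝ) (x₀ : E3) (r : ℝ)
    (h0 : (connectedComponentIn (sphCrit f x₀ r) '' sphCrit f x₀ r).Finite)
    (h1 : (connectedComponentIn (Metric.sphere x₀ r \ sphCrit f x₀ r) '' (Metric.sphere x₀ r \ sphCrit f x₀ r)).Finite) :
    (cellSet f x₀ r).Finite ∧
      (cellSet f x₀ r).ncard ≤ (connectedComponentIn (Metric.sphere x₀ r \ sphCrit f x₀ r) '' (Metric.sphere x₀ r \ sphCrit f x₀ r)).ncard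
        + (connectedComponentIn (sphCrit f x₀ r) '' sphCrit f x₀ r).ncard := by
  obtain ⟨hiso, hisoN⟩ := isoCrit_finite_of_components_finite f x₀ r h0
  have hcell : cellSet f x₀ r =
      connectedComponentIn (Metric.sphere x₀ r \ sheetTrace f x₀ r) '' (Metric.sphere x₀ r \ sphCrit f x₀ r) ∪
        connectedComponentIn (Metric.sphere x₀ r \ sheetTrace f x₀ r) '' isoCrit f x₀ r := by
    unfold cellSet cellOf
    rw [← image_union, ← sphere_diff_sheetTrace_eq]
  have hsub : Metric.sphere x₀ r \ sphCrit f x₀ r ⊆ Metric.sphere x₀ r \ sheetTrace f x₀ r := by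
    rw [sphere_diff_sheetTrace_eq]; exact subset_union_left
  have hA := finite_image_connectedComponentIn_of_subset hsub h1
  have hAN := ncard_image_connectedComponentIn_of_subset_le hsub h1
  rw [hcell]
  refine ⟨hA.union (hiso.image _), (ncard_union_le _ _).trans (add_le_add hAN ?_)⟩
  exact (ncard_image_le hiso).trans hisoN

/-- ★ **Λ-geo from F1**: `BierstoneMilman1988_signSet_components_finite → AnalyticCellFiniteness`, both bodies VERBATIM from
`Cruxes/PoloidalLiouville/IndicatrixSketch.lean` v1.7.3 (§F l.615 and §1 l.309). [folklore] -/
theorem analyticCellFiniteness_of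
    (hF1 : ∀ (E : Type) [NormedAddCommGroup E] [NormedSpace ℝ E] [FiniteDimensional ℝ E] (U : Set E) (h g : E → ℝ),
      IsOpen U → AnalyticOnNhd ℝ h U → AnalyticOnNhd ℝ g U → IsCompact {x | x ∈ U ∧ h x = 0} →
        (connectedComponentIn {x | x ∈ U ∧ h x = 0 ∧ g x = 0} '' {x | x ∈ U ∧ h x = 0 ∧ g x = 0}).Finite ∧
        (connectedComponentIn {x | x ∈ U ∧ h x = 0 ∧ g x ≠ 0} '' {x | x ∈ U ∧ h x = 0 ∧ g x ≠ 0}).Finite) :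
    ∀ (x₀ : E3) (f : E3 → ℝ) (r : ℝ), 0 < r → AnalyticOnNhd ℝ f ({x₀}ᶜ : Set E3) →
      (cellSet f x₀ r).Finite ∧ (isoCrit f x₀ r).Finite := by
  intro x₀ f r hr hf
  have hcpt : IsCompact {x : E3 | x ∈ ({x₀}ᶜ : Set E3) ∧ ‖x - x₀‖ ^ 2 - r ^ 2 = 0} := by
    rw [zeroSet_h_eq_sphere x₀ hr]; exact isCompact_sphere _ _
  obtain ⟨h0, h1⟩ := hF1 E3 ({x₀}ᶜ : Set E3) (fun x => ‖x - x₀‖ ^ 2 - r ^ 2)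
    (fun x => ‖cross (gradient f x) (x - x₀)‖ ^ 2) isOpen_compl_singleton (analyticOnNhd_h x₀ r _) (analyticOnNhd_g hf x₀) hcpt
  rw [← sphCrit_eq_signSet' f x₀ hr] at h0
  rw [← sphere_diff_sphCrit_eq_signSet f x₀ hr] at h1
  exact ⟨(cellSet_finite_of_components_finite f x₀ r h0 h1).1, (isoCrit_finite_of_components_finite f x₀ r h0).1⟩

/-- ★ **Λ-geo BY NAME modulo the one standing fact «`ℝ_an,exp` is o-minimal»**: F1 is the tree theorem
`Literature.Analysis.Calculus.analyticSignSet_connectedComponents_finite_of_realAnExp_isOMinimal` (p710694). [folklore] -/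
theorem analyticCellFiniteness_of_realAnExp
    (hO : Literature.ModelTheory.ExponentialFields.VandendriesMiller1994_realAnExp_isOMinimal) :
    ∀ (x₀ : E3) (f : E3 → ℝ) (r : ℝ), 0 < r → AnalyticOnNhd ℝ f ({x₀}ᶜ : Set E3) →
      (cellSet f x₀ r).Finite ∧ (isoCrit f x₀ r).Finite :=
  analyticCellFiniteness_of
    (Literature.Analysis.Calculus.analyticSignSet_connectedComponents_finite_of_realAnExp_isOMinimal hO)

end Summit.NavierStokesRegularity.NavierStokesRegularity.Theorems.PoloidalLiouville.Indicatrix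

end
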